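import Literature.AlgebraicGeometry.Deformation.T1Lifting
import Mathlib.Algebra.Polynomial.Div
import Mathlib.Algebra.Polynomial.Degree.TrailingDegree
import Mathlib.RingTheory.MvPolynomial.Basic
import Mathlib.RingTheory.Ideal.Quotient.Operations
import HarnessLib

/-!
# [FM98] Example 5.7 (ii): relative curvilinear lifting does not imply smoothness

[FantechiManetti1998ObstructionCalculus] = B. Fantechi, M. Manetti, «Obstruction calculus for functors of Artin
rings, I», J. Algebra 202 (1998) 541–576, p. 562:

«EXAMPLE 5.7. … (ii) Let `R = k[x, y]/(x³, y³, x²y²)`, and let `S = k[x, y]/(x³, y³)`. Then the morphism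
`h_R → h_S` has no relative curvilinear obstructions.» (read on the held publisher text layer, store
`paper:doi-10-1006-jabr-1997-7239`, (ii) = p. 562 L7–8, where the quotient slash after `k[x, y]` in the
definition of `R` is absent — «`k[x, y](x³, y³, x²y²)`», a printed slip or an extraction loss (no page image
obtainable); the intended `R = k[x, y]/(x³, y³, x²y²)` is forced by (i) of the same Example (p. 561 L66 –
p. 562 L6, which prints this `R` with the slash) and by the Remark below.)
«Remark. The above examples show that a morphism in Gdt without relative curvilinear obstructions is not
necessarily smooth, even in the prorepresentable case and algebraically closed ground field. Therefore the
above Lemma 5.6 does not generalize to the relative case».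

(Lemma 5.6 itself — curvilinear surjectivity ⇒ `h_R` smooth, the ABSOLUTE case — is the tree file
`CurvilinearSmoothness.lean`.)

What is typed here, for ANY field `k` (theorems only; `A_N = k[t]/(t^(N+1))` and `Art_k` are those of
`T1Lifting.lean`, `h_R` = `ArtinFunctor.points R` = all `k`-algebra maps out of `R`):
* the computation behind (ii): a `k`-algebra map `S → A_N` kills `x²y²` — in `A_N`, `u³ = v³ = 0 ⇒ u²v² = 0`
  (`T1Lifting.sq_mul_sq_eq_zero_of_cube_eq_zero`, `FM98Example57.map_sq_mul_sq_eq_zero`); hence EVERY curve of `S`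
  factors through `R`: `h_R(A_N) → h_S(A_N)` is a bijection for every `N` (`FM98Example57.points_comp_bijective`);
* consequently the relative curvilinear LIFTING property `h_R(A_(N+1)) → h_R(A_N) ×_{h_S(A_N)} h_S(A_(N+1))`
  onto for every `N` (`FM98Example57.relative_curvilinear_lifting`) — which IS «no relative curvilinear
  obstructions» by the paper's own statements: a curvilinear obstruction is an `ob_e`-image for a curvilinear
  extension `e` (Def. 3.5, p. 552), the curvilinear extensions being «`0 → k → k[t]/(t^(n+1)) → k[t]/(t^n) → 0`»
  (p. 545); lifting ⇒ vanishing (Prop. 3.3, p. 551) and conversely for a COMPLETE theory (Def. 4.1, p. 552);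
  the universal relative theory `O_n` [morphism letter as extracted] of `h_R → h_S` is complete by Cor. 4.13
  (p. 559: «If either `n : t_F → t_G` is surjective or `G` satisfies (H4), then `O_n` is complete») since «the
  functors `h_R` are left-exact» and «left-exact ⇒ homogeneous ⇒ (H1), (H2) and (H4)» (p. 546) — cf. the proof
  of Prop. 5.8 (p. 562): «As `O_n` is complete, there must be a nontrivial curvilinear obstruction»; the
  obstruction spaces themselves are not typed here;
* the Remark's «not necessarily smooth»: there is a `B ∈ Art_k` (namely `S` itself, modelled as `A_2[y]/(y³)`) with
  `h_R(B) → h_S(B)` NOT onto (`FM98Example57.points_comp_not_surjective`) — the negation of the printed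
  consequence of smoothness «if `n` is smooth, then `F(A) → G(A)` is surjective for all `A ∈ Art_k`» (p. 548,
  after Def. 2.15, whose smoothness quantifies over SMALL extensions); and, literally the failure of the
  smoothness condition in Schlessinger's form [Schlessinger1968, Def. 2.2] («`F(B) → F(A) ×_{G(A)} G(B)` onto
  for every surjection `B ↠ A`»; = Def. 2.15 by factoring surjections into small extensions), a surjection
  `q : B ↠ A_0 = k` with compatible points `a ∈ h_R(A_0)`, `b ∈ h_S(B)` admitting no common lift in `h_R(B)`
  (`FM98Example57.not_smooth`).
No obstruction theory, no `Λ`-algebra structure and no geometric object is instantiated.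
-/

open Polynomial

namespace Literature.AlgebraicGeometry.Deformation

universe u
variable (k : Type u) [Field k]

namespace T1Lifting

/-- Over a field: if `X ^ m` divides `p ^ 3` and `q ^ 3` then it divides `p ^ 2 * q ^ 2`
(trailing degrees: `3a ≥ m`, `3b ≥ m` ⇒ `2a + 2b ≥ m`). [folklore] -/
private theorem X_pow_dvd_sq_mul_sq {m : ℕ} {p q : k[X]} (hp : (X : k[X]) ^ m ∣ p ^ 3)
    (hq : (X : k[X]) ^ m ∣ q ^ 3) : (X : k[X]) ^ m ∣ p ^ 2 * q ^ 2 := by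
  by_cases hp0 : p = 0
  · subst hp0; simp
  by_cases hq0 : q = 0
  · subst hq0; simp
  have h3 : ∀ r : k[X], r ≠ 0 → (r ^ 3).natTrailingDegree = 3 * r.natTrailingDegree := by
    intro r hr
    have h2 : (r * r).natTrailingDegree = r.natTrailingDegree + r.natTrailingDegree :=
      natTrailingDegree_mul hr hr
    have : (r * r * r).natTrailingDegree = (r * r).natTrailingDegree + r.natTrailingDegree :=
      natTrailingDegree_mul (mul_ne_zero hr hr) hr
    rw [show r ^ 3 = r * r * r by ring, this, h2]; ring
  have hp' : m ≤ 3 * p.natTrailingDegree := by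
    rw [← h3 p hp0]; exact le_natTrailingDegree (pow_ne_zero 3 hp0) (X_pow_dvd_iff.1 hp)
  have hq' : m ≤ 3 * q.natTrailingDegree := by
    rw [← h3 q hq0]; exact le_natTrailingDegree (pow_ne_zero 3 hq0) (X_pow_dvd_iff.1 hq)
  have hpq : (p ^ 2 * q ^ 2).natTrailingDegree = 2 * p.natTrailingDegree + 2 * q.natTrailingDegree := by
    have h2p : (p * p).natTrailingDegree = p.natTrailingDegree + p.natTrailingDegree :=
      natTrailingDegree_mul hp0 hp0
    have h2q : (q * q).natTrailingDegree = q.natTrailingDegree + q.natTrailingDegree :=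
      natTrailingDegree_mul hq0 hq0
    have : (p * p * (q * q)).natTrailingDegree = (p * p).natTrailingDegree + (q * q).natTrailingDegree :=
      natTrailingDegree_mul (mul_ne_zero hp0 hp0) (mul_ne_zero hq0 hq0)
    rw [show p ^ 2 * q ^ 2 = p * p * (q * q) by ring, this, h2p, h2q]; ring
  refine X_pow_dvd_iff.2 fun d hd => coeff_eq_zero_of_lt_natTrailingDegree ?_
  rw [hpq]; omega

/-- The computation behind [FM98] Example 5.7 (ii), in the curvilinear algebra `A_N = k[t]/(t^(N+1))`:
`u³ = 0` and `v³ = 0` imply `u²v² = 0` (orders: `3·ord u ≥ N + 1`, `3·ord v ≥ N + 1` ⇒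
`ord(u²v²) ≥ 4(N+1)/3 ≥ N + 1`). [cite: FantechiManetti1998ObstructionCalculus, Ex. 5.7 (ii)] -/
theorem sq_mul_sq_eq_zero_of_cube_eq_zero (N : ℕ) {u v : A k N} (hu : u ^ 3 = 0) (hv : v ^ 3 = 0) :
    u ^ 2 * v ^ 2 = 0 := by
  obtain ⟨p, rfl⟩ := AdjoinRoot.mk_surjective u
  obtain ⟨q, rfl⟩ := AdjoinRoot.mk_surjective v
  rw [← map_pow, AdjoinRoot.mk_eq_zero] at hu hv
  rw [← map_pow, ← map_pow, ← map_mul, AdjoinRoot.mk_eq_zero]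
  exact X_pow_dvd_sq_mul_sq k hu hv

end T1Lifting

namespace FM98Example57

open MvPolynomial in
/-- [FM98] Example 5.7 (ii), the computation: with `S = k[x, y]/(x³, y³)`, EVERY `k`-algebra map `S → A_N`
(every curvilinear point of `S`) kills `x²y²`. [cite: FantechiManetti1998ObstructionCalculus, Ex. 5.7 (ii)] -/
theorem map_sq_mul_sq_eq_zero (N : ℕ)
    (φ : (MvPolynomial (Fin 2) k ⧸ Ideal.span {(X 0 : MvPolynomial (Fin 2) k) ^ 3, X 1 ^ 3}) →ₐ[k]
      T1Lifting.A k N) :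
    φ (Ideal.Quotient.mk _ (X 0 ^ 2 * X 1 ^ 2)) = 0 := by
  have h0 : (φ (Ideal.Quotient.mk _ (X 0))) ^ 3 = 0 := by
    rw [← map_pow, ← map_pow, Ideal.Quotient.eq_zero_iff_mem.2 (Ideal.subset_span (by simp)), map_zero]
  have h1 : (φ (Ideal.Quotient.mk _ (X 1))) ^ 3 = 0 := by
    rw [← map_pow, ← map_pow, Ideal.Quotient.eq_zero_iff_mem.2 (Ideal.subset_span (by simp)), map_zero]
  rw [map_mul, map_pow, map_pow, map_mul, map_pow, map_pow]
  exact T1Lifting.sq_mul_sq_eq_zero_of_cube_eq_zero k N h0 h1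

/-- The inclusion of ideals `(x³, y³) ⊆ (x³, y³, x²y²)` behind the projection `S → R` of [FM98] Example 5.7 (ii).
[cite: FantechiManetti1998ObstructionCalculus, Ex. 5.7 (ii)] -/
theorem span_le :
    Ideal.span {(MvPolynomial.X 0 : MvPolynomial (Fin 2) k) ^ 3, MvPolynomial.X 1 ^ 3} ≤
      Ideal.span {(MvPolynomial.X 0 : MvPolynomial (Fin 2) k) ^ 3, MvPolynomial.X 1 ^ 3,
        MvPolynomial.X 0 ^ 2 * MvPolynomial.X 1 ^ 2} :=
  Ideal.span_mono fun a ha => by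
    simp only [Set.mem_insert_iff, Set.mem_singleton_iff] at ha ⊢
    tauto

open MvPolynomial in
/-- [FM98] Example 5.7 (ii) for the functors of points: with `R = k[x, y]/(x³, y³, x²y²)`,
`S = k[x, y]/(x³, y³)` and `π : S → R` the projection, composition with `π` is a BIJECTION
`h_R(A_N) → h_S(A_N)` for every `N` — every curvilinear point of `S` factors (uniquely) through `R`.
[cite: FantechiManetti1998ObstructionCalculus, Ex. 5.7 (ii)] -/
theorem points_comp_bijective (N : ℕ) :
    Function.Bijective fun ψ : (MvPolynomial (Fin 2) k ⧸ Ideal.span {(X 0 : MvPolynomial (Fin 2) k) ^ 3,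
        X 1 ^ 3, X 0 ^ 2 * X 1 ^ 2}) →ₐ[k] T1Lifting.A k N =>
      ψ.comp (Ideal.Quotient.factorₐ k (span_le k)) := by
  set I : Ideal (MvPolynomial (Fin 2) k) := Ideal.span {(X 0 : MvPolynomial (Fin 2) k) ^ 3, X 1 ^ 3} with hI
  set J : Ideal (MvPolynomial (Fin 2) k) :=
    Ideal.span {(X 0 : MvPolynomial (Fin 2) k) ^ 3, X 1 ^ 3, X 0 ^ 2 * X 1 ^ 2} with hJ
  have hππ : (Ideal.Quotient.factorₐ k (span_le k)).comp (Ideal.Quotient.mkₐ k I) =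
      Ideal.Quotient.mkₐ k J := Ideal.Quotient.factorₐ_comp_mk k (span_le k)
  constructor
  · intro ψ₁ ψ₂ h
    apply Ideal.Quotient.algHom_ext
    simp only at h
    rw [← hππ, ← AlgHom.comp_assoc, h, AlgHom.comp_assoc]
  · intro φ
    have hker : ∀ a ∈ J, φ.comp (Ideal.Quotient.mkₐ k I) a = 0 := by
      intro a ha
      have hsub : ({(X 0 : MvPolynomial (Fin 2) k) ^ 3, X 1 ^ 3, X 0 ^ 2 * X 1 ^ 2} : Set _) ⊆
          RingHom.ker (φ.comp (Ideal.Quotient.mkₐ k I)) := by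
        intro b hb
        simp only [Set.mem_insert_iff, Set.mem_singleton_iff] at hb
        rw [SetLike.mem_coe, RingHom.mem_ker]
        rcases hb with rfl | rfl | rfl
        · rw [AlgHom.coe_comp, Function.comp_apply, Ideal.Quotient.mkₐ_eq_mk,
            Ideal.Quotient.eq_zero_iff_mem.2 (Ideal.subset_span (by simp)), map_zero]
        · rw [AlgHom.coe_comp, Function.comp_apply, Ideal.Quotient.mkₐ_eq_mk,
            Ideal.Quotient.eq_zero_iff_mem.2 (Ideal.subset_span (by simp)), map_zero]
        · rw [AlgHom.coe_comp, Function.comp_apply, Ideal.Quotient.mkₐ_eq_mk]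
          exact map_sq_mul_sq_eq_zero k N φ
      exact (RingHom.mem_ker).1 (Ideal.span_le.2 hsub ha)
    refine ⟨Ideal.Quotient.liftₐ J (φ.comp (Ideal.Quotient.mkₐ k I)) hker, ?_⟩
    apply Ideal.Quotient.algHom_ext
    simp only
    rw [AlgHom.comp_assoc, hππ, Ideal.Quotient.liftₐ_comp]

open MvPolynomial in
/-- [FM98] Example 5.7 (ii), the RELATIVE CURVILINEAR LIFTING property of `h_R → h_S` (= «no relative curvilinear
obstructions» by Def. 3.5, Prop. 3.3, Def. 4.1 and Cor. 4.13 of the same paper, `h_S` being left-exact): for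
every `N`, every point `a ∈ h_R(A_N)` and every curvilinear extension
`b ∈ h_S(A_(N+1))` of its image (`i ∘ b = a ∘ π`, `i : A_(N+1) → A_N`) there is `b' ∈ h_R(A_(N+1))` over both
(`i ∘ b' = a`, `b' ∘ π = b`). [cite: FantechiManetti1998ObstructionCalculus, Ex. 5.7 (ii)] -/
theorem relative_curvilinear_lifting (N : ℕ)
    (a : (MvPolynomial (Fin 2) k ⧸ Ideal.span {(X 0 : MvPolynomial (Fin 2) k) ^ 3, X 1 ^ 3,
        X 0 ^ 2 * X 1 ^ 2}) →ₐ[k] T1Lifting.A k N)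
    (b : (MvPolynomial (Fin 2) k ⧸ Ideal.span {(X 0 : MvPolynomial (Fin 2) k) ^ 3, X 1 ^ 3}) →ₐ[k]
        T1Lifting.A k (N + 1))
    (hab : (T1Lifting.i k N).comp b = a.comp (Ideal.Quotient.factorₐ k (span_le k))) :
    ∃ b' : (MvPolynomial (Fin 2) k ⧸ Ideal.span {(X 0 : MvPolynomial (Fin 2) k) ^ 3, X 1 ^ 3,
        X 0 ^ 2 * X 1 ^ 2}) →ₐ[k] T1Lifting.A k (N + 1),
      (T1Lifting.i k N).comp b' = a ∧ b'.comp (Ideal.Quotient.factorₐ k (span_le k)) = b := by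
  obtain ⟨b', hb'⟩ := (points_comp_bijective k (N + 1)).2 b
  refine ⟨b', (points_comp_bijective k N).1 ?_, hb'⟩
  simp only at hb' ⊢
  rw [AlgHom.comp_assoc, hb', hab]

/-- A «fat point» of `Art_k` for the Remark: a `B ∈ Art_k` (namely `A_2[y]/(y³) ≅ k[x, y]/(x³, y³)`, i.e.
`S` itself) with elements `u, v`, `u³ = v³ = 0` but `u²v² ≠ 0`, together with a surjection `q : B → A_0 = k`
killing `u` and `v`. The `Art_k` structure (finite over `k` hence Artinian; local by the unit-or-nilpotent
dichotomy; augmentation `y ↦ 0`) is assembled inside the proof. [folklore] -/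
private theorem exists_fat_point :
    ∃ (B : ArtAlg.{u} k) (u v : B) (q : B →ₐ[k] T1Lifting.A k 0),
      u ^ 3 = 0 ∧ v ^ 3 = 0 ∧ u ^ 2 * v ^ 2 ≠ 0 ∧ Function.Surjective q ∧ q u = 0 ∧ q v = 0 := by
  let T : Type u := AdjoinRoot ((Polynomial.X : (T1Lifting.A k 2)[X]) ^ 3)
  have hmon : ((Polynomial.X : (T1Lifting.A k 2)[X]) ^ 3).Monic := monic_X_pow 3
  haveI : Module.Finite (T1Lifting.A k 2) T := (AdjoinRoot.powerBasis' hmon).finite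
  haveI : Module.Finite k T := Module.Finite.trans (T1Lifting.A k 2) T
  haveI : IsArtinianRing T := IsArtinianRing.of_finite k T
  haveI : Nontrivial T := nontrivial_of_ne (AdjoinRoot.mk _ Polynomial.X) 0
    (AdjoinRoot.mk_ne_zero_of_degree_lt hmon Polynomial.X_ne_zero
      (by rw [Polynomial.degree_X_pow, Polynomial.degree_X]; exact_mod_cast (by norm_num : (1 : ℕ) < 3)))
  have hy3 : (AdjoinRoot.root ((Polynomial.X : (T1Lifting.A k 2)[X]) ^ 3)) ^ 3 = 0 := by
    rw [← AdjoinRoot.mk_X, ← map_pow, AdjoinRoot.mk_self]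
  have ht3 : (algebraMap (T1Lifting.A k 2) T (T1Lifting.t k 2)) ^ 3 = 0 := by
    rw [← map_pow, T1Lifting.t_pow_succ, map_zero]
  haveI : IsLocalRing T := by
    refine .of_isUnit_or_isUnit_one_sub_self fun s => ?_
    obtain ⟨p, rfl⟩ := AdjoinRoot.mk_surjective s
    obtain ⟨c, b, hcb⟩ := T1Lifting.exists_eq_algebraMap_add_t_mul k 2 (p.coeff 0)
    -- `s = c + (t·b + y·q)` with the bracket nilpotent
    have hs : AdjoinRoot.mk _ p = algebraMap k T c +
        (algebraMap (T1Lifting.A k 2) T (T1Lifting.t k 2 * b) +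
          AdjoinRoot.root _ * AdjoinRoot.mk ((Polynomial.X : (T1Lifting.A k 2)[X]) ^ 3) p.divX) := by
      conv_lhs => rw [← X_mul_divX_add p]
      rw [map_add, map_mul, AdjoinRoot.mk_X, AdjoinRoot.mk_C, hcb, map_add, ← AdjoinRoot.algebraMap_eq,
        IsScalarTower.algebraMap_apply k (T1Lifting.A k 2) T c]
      ring
    have hnil : IsNilpotent (algebraMap (T1Lifting.A k 2) T (T1Lifting.t k 2 * b) +
        AdjoinRoot.root _ * AdjoinRoot.mk ((Polynomial.X : (T1Lifting.A k 2)[X]) ^ 3) p.divX) := by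
      refine Commute.isNilpotent_add (Commute.all _ _) ⟨3, ?_⟩ ⟨3, ?_⟩
      · rw [map_mul, mul_pow, ht3, zero_mul]
      · rw [mul_pow, hy3, zero_mul]
    rw [hs]
    by_cases hc : c = 0
    · refine Or.inr ?_
      rw [hc, map_zero, zero_add, sub_eq_add_neg]
      exact hnil.neg.isUnit_one_add
    · exact Or.inl (hnil.isUnit_add_left_of_commute ((Ne.isUnit hc).map (algebraMap k T)) (Commute.all _ _))
  let aug : T →ₐ[k] k := AdjoinRoot.liftAlgHom _ (T1Lifting.augA k 2) 0 (by simp)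
  let q : T →ₐ[k] T1Lifting.A k 0 := (Algebra.ofId k (T1Lifting.A k 0)).comp aug
  refine ⟨{ carrier := T, exists_augmentation := ⟨aug⟩ }, algebraMap (T1Lifting.A k 2) T (T1Lifting.t k 2),
    AdjoinRoot.root _, q, ht3, hy3, ?_, ?_, ?_, ?_⟩
  · -- `t² y² ≠ 0` in `A_2[y]/(y³)`
    have e2 : (algebraMap (T1Lifting.A k 2) T (T1Lifting.t k 2)) ^ 2 *
          (AdjoinRoot.root ((Polynomial.X : (T1Lifting.A k 2)[X]) ^ 3)) ^ 2 =
        AdjoinRoot.mk _ (Polynomial.C (T1Lifting.t k 2 ^ 2) * Polynomial.X ^ 2) := by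
      simp only [map_mul, map_pow, AdjoinRoot.mk_C, AdjoinRoot.mk_X]
      rfl
    rw [e2]
    exact AdjoinRoot.mk_ne_zero_of_degree_lt hmon
      (by rw [Ne, Polynomial.C_mul_X_pow_eq_monomial, Polynomial.monomial_eq_zero_iff]
          exact T1Lifting.t_pow_ne_zero k 2)
      (by rw [Polynomial.degree_C_mul_X_pow 2 (T1Lifting.t_pow_ne_zero k 2), Polynomial.degree_X_pow]
          exact_mod_cast Nat.lt_succ_self 2)
  · -- `q` is onto `A_0 = k[t]/(t)`
    intro a
    obtain ⟨c, b, rfl⟩ := T1Lifting.exists_eq_algebraMap_add_t_mul k 0 a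
    refine ⟨algebraMap k T c, ?_⟩
    rw [AlgHom.commutes, ← pow_one (T1Lifting.t k 0), T1Lifting.t_pow_succ, zero_mul, add_zero]
  · -- `q(t) = 0`
    change algebraMap k (T1Lifting.A k 0) (aug (algebraMap (T1Lifting.A k 2) T (T1Lifting.t k 2))) = 0
    rw [AdjoinRoot.algebraMap_eq]
    change algebraMap k (T1Lifting.A k 0) (aug (AdjoinRoot.of _ (T1Lifting.t k 2))) = 0
    rw [AdjoinRoot.liftAlgHom_of, T1Lifting.augA_t, map_zero]
  · -- `q(y) = 0`
    change algebraMap k (T1Lifting.A k 0) (aug (AdjoinRoot.root _)) = 0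
    rw [AdjoinRoot.liftAlgHom_root, map_zero]

open MvPolynomial in
/-- A point of `S = k[x, y]/(x³, y³)` with prescribed values `u, v` (`u³ = v³ = 0`) in any `k`-algebra. [folklore] -/
private theorem exists_point {B : Type u} [CommRing B] [Algebra k B] (u v : B) (hu : u ^ 3 = 0)
    (hv : v ^ 3 = 0) :
    ∃ b : (MvPolynomial (Fin 2) k ⧸ Ideal.span {(X 0 : MvPolynomial (Fin 2) k) ^ 3, X 1 ^ 3}) →ₐ[k] B,
      b (Ideal.Quotient.mk _ (X 0)) = u ∧ b (Ideal.Quotient.mk _ (X 1)) = v := by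
  set I : Ideal (MvPolynomial (Fin 2) k) := Ideal.span {(X 0 : MvPolynomial (Fin 2) k) ^ 3, X 1 ^ 3} with hI
  have hker : ∀ a ∈ I, MvPolynomial.aeval (R := k) (![u, v] : Fin 2 → B) a = 0 := by
    intro a ha
    have hsub : ({(X 0 : MvPolynomial (Fin 2) k) ^ 3, X 1 ^ 3} : Set _) ⊆
        RingHom.ker (MvPolynomial.aeval (R := k) (![u, v] : Fin 2 → B)) := by
      intro b hb
      simp only [Set.mem_insert_iff, Set.mem_singleton_iff] at hb
      rw [SetLike.mem_coe, RingHom.mem_ker]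
      rcases hb with rfl | rfl
      · simp only [map_pow, MvPolynomial.aeval_X, Matrix.cons_val_zero]; exact hu
      · simp only [map_pow, MvPolynomial.aeval_X, Matrix.cons_val_one]; exact hv
    exact (RingHom.mem_ker).1 (Ideal.span_le.2 hsub ha)
  refine ⟨Ideal.Quotient.liftₐ I (MvPolynomial.aeval (R := k) (![u, v] : Fin 2 → B)) hker, ?_, ?_⟩
  · change Ideal.Quotient.lift I _ hker (Ideal.Quotient.mk I _) = _
    rw [Ideal.Quotient.lift_mk]
    change MvPolynomial.aeval (R := k) (![u, v] : Fin 2 → B) (X 0) = u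
    rw [MvPolynomial.aeval_X]; rfl
  · change Ideal.Quotient.lift I _ hker (Ideal.Quotient.mk I _) = _
    rw [Ideal.Quotient.lift_mk]
    change MvPolynomial.aeval (R := k) (![u, v] : Fin 2 → B) (X 1) = v
    rw [MvPolynomial.aeval_X]; rfl

open MvPolynomial in
/-- [FM98] p. 562, Remark after Example 5.7, for the morphism `h_R → h_S` of (ii), against the printed consequence
of smoothness «if `n` is smooth, then `F(A) → G(A)` is surjective for all `A ∈ Art_k`» (p. 548, after Def. 2.15):
there is a `B ∈ Art_k` (namely `S` itself, realised as `A_2[y]/(y³)`) such that `h_R(B) → h_S(B)`, `ψ ↦ ψ ∘ π`,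
is NOT surjective — the tautological point of `S` in `B` does not kill `x²y²`. So `h_R → h_S` is not smooth in
the sense of [FM98] Def. 2.15. [cite: FantechiManetti1998ObstructionCalculus, p. 562 Remark and p. 548] -/
theorem points_comp_not_surjective :
    ∃ B : ArtAlg.{u} k, ¬ Function.Surjective fun ψ : (MvPolynomial (Fin 2) k ⧸
        Ideal.span {(X 0 : MvPolynomial (Fin 2) k) ^ 3, X 1 ^ 3, X 0 ^ 2 * X 1 ^ 2}) →ₐ[k] B =>
      ψ.comp (Ideal.Quotient.factorₐ k (span_le k)) := by
  obtain ⟨B, u, v, -, hu, hv, huv, -, -, -⟩ := exists_fat_point k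
  obtain ⟨b, hb0, hb1⟩ := exists_point k u v hu hv
  refine ⟨B, fun hsurj => huv ?_⟩
  obtain ⟨ψ, hψ⟩ := hsurj b
  have hπ : Ideal.Quotient.factorₐ k (span_le k)
      (Ideal.Quotient.mk _ ((X 0 : MvPolynomial (Fin 2) k) ^ 2 * X 1 ^ 2)) = 0 := by
    rw [Ideal.Quotient.factorₐ_apply_mk, Ideal.Quotient.eq_zero_iff_mem]
    exact Ideal.subset_span (by simp)
  have := AlgHom.congr_fun hψ (Ideal.Quotient.mk _ ((X 0 : MvPolynomial (Fin 2) k) ^ 2 * X 1 ^ 2))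
  simp only [AlgHom.coe_comp, Function.comp_apply] at this
  rw [hπ, map_zero] at this
  simp only [map_mul, map_pow] at this
  rw [hb0, hb1] at this
  exact this.symm

open MvPolynomial in
/-- [FM98] p. 562, Remark after Example 5.7: «The above examples show that a morphism in Gdt without relative
curvilinear obstructions is not necessarily smooth, even in the prorepresentable case and algebraically closed
ground field. Therefore the above Lemma 5.6 does not generalize to the relative case» — for the morphism
`h_R → h_S` of Example 5.7 (ii), AS A FAILURE OF THE SMOOTHNESS CONDITION in Schlessinger's form
[Schlessinger1968, Def. 2.2] («`F(B) → F(A) ×_{G(A)} G(B)` is surjective for every surjection `B → A`»; [FM98]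
Def. 2.15 asks it for small extensions, to which it reduces by factoring surjections): there are a surjection
`q : B ↠ A` in `Art_k` (namely `B = A_2[y]/(y³) ≅ S`, `A = A_0 = k`; NOT a small extension), a point
`a ∈ h_R(A)` and a point `b ∈ h_S(B)` with the same image in `h_S(A)` (`q ∘ b = a ∘ π`) such that NO
`b' ∈ h_R(B)` lies over both. Holds for every field `k`.
[cite: FantechiManetti1998ObstructionCalculus, p. 562 Remark] [cite: Schlessinger1968, Def. 2.2] -/
theorem not_smooth :
    ∃ (B A : ArtAlg.{u} k) (q : B →ₐ[k] A), Function.Surjective q ∧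
      ∃ (a : (MvPolynomial (Fin 2) k ⧸ Ideal.span {(X 0 : MvPolynomial (Fin 2) k) ^ 3, X 1 ^ 3,
            X 0 ^ 2 * X 1 ^ 2}) →ₐ[k] A)
        (b : (MvPolynomial (Fin 2) k ⧸ Ideal.span {(X 0 : MvPolynomial (Fin 2) k) ^ 3, X 1 ^ 3}) →ₐ[k] B),
        q.comp b = a.comp (Ideal.Quotient.factorₐ k (span_le k)) ∧
        ¬ ∃ b' : (MvPolynomial (Fin 2) k ⧸ Ideal.span {(X 0 : MvPolynomial (Fin 2) k) ^ 3, X 1 ^ 3,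
            X 0 ^ 2 * X 1 ^ 2}) →ₐ[k] B,
          q.comp b' = a ∧ b'.comp (Ideal.Quotient.factorₐ k (span_le k)) = b := by
  obtain ⟨B, u, v, q, hu, hv, huv, hq, hqu, hqv⟩ := exists_fat_point k
  obtain ⟨b, hb0, hb1⟩ := exists_point k u v hu hv
  have hππ : (Ideal.Quotient.factorₐ k (span_le k)).comp (Ideal.Quotient.mkₐ k _) =
      Ideal.Quotient.mkₐ k _ := Ideal.Quotient.factorₐ_comp_mk k (span_le k)
  -- the image of `b` in `h_S(A_0)` factors through `R` (it kills `x²y²`, indeed `x` and `y`)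
  have hker : ∀ m ∈ Ideal.span {(X 0 : MvPolynomial (Fin 2) k) ^ 3, X 1 ^ 3, X 0 ^ 2 * X 1 ^ 2},
      (q.comp b).comp (Ideal.Quotient.mkₐ k _) m = 0 := by
    intro m hm
    have hsub : ({(X 0 : MvPolynomial (Fin 2) k) ^ 3, X 1 ^ 3, X 0 ^ 2 * X 1 ^ 2} : Set _) ⊆
        RingHom.ker ((q.comp b).comp (Ideal.Quotient.mkₐ k
          (Ideal.span {(X 0 : MvPolynomial (Fin 2) k) ^ 3, X 1 ^ 3}))) := by
      intro m hm
      simp only [Set.mem_insert_iff, Set.mem_singleton_iff] at hm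
      rw [SetLike.mem_coe, RingHom.mem_ker]
      rcases hm with rfl | rfl | rfl
      · rw [AlgHom.coe_comp, Function.comp_apply, Ideal.Quotient.mkₐ_eq_mk,
          Ideal.Quotient.eq_zero_iff_mem.2 (Ideal.subset_span (by simp)), map_zero]
      · rw [AlgHom.coe_comp, Function.comp_apply, Ideal.Quotient.mkₐ_eq_mk,
          Ideal.Quotient.eq_zero_iff_mem.2 (Ideal.subset_span (by simp)), map_zero]
      · rw [AlgHom.coe_comp, Function.comp_apply, Ideal.Quotient.mkₐ_eq_mk, AlgHom.coe_comp,
          Function.comp_apply]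
        simp only [map_mul, map_pow]
        rw [hb0, hb1, hqu, hqv]
        norm_num
    exact (RingHom.mem_ker).1 (Ideal.span_le.2 hsub hm)
  refine ⟨B, T1Lifting.artA k 0, q, hq, Ideal.Quotient.liftₐ _ ((q.comp b).comp (Ideal.Quotient.mkₐ k _)) hker,
    b, ?_, ?_⟩
  · apply Ideal.Quotient.algHom_ext
    symm
    rw [AlgHom.comp_assoc, hππ, Ideal.Quotient.liftₐ_comp]
  · rintro ⟨b', -, hb'⟩
    apply huv
    have hπ : Ideal.Quotient.factorₐ k (span_le k)
        (Ideal.Quotient.mk _ ((X 0 : MvPolynomial (Fin 2) k) ^ 2 * X 1 ^ 2)) = 0 := by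
      rw [Ideal.Quotient.factorₐ_apply_mk, Ideal.Quotient.eq_zero_iff_mem]
      exact Ideal.subset_span (by simp)
    have := AlgHom.congr_fun hb' (Ideal.Quotient.mk _ ((X 0 : MvPolynomial (Fin 2) k) ^ 2 * X 1 ^ 2))
    simp only [AlgHom.coe_comp, Function.comp_apply] at this
    rw [hπ, map_zero] at this
    simp only [map_mul, map_pow] at this
    rw [hb0, hb1] at this
    exact this.symm

end FM98Example57

end Literature.AlgebraicGeometry.Deformation
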